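import Summits.QuantumAdvantage.QuantumAdvantage.Theorems.ShadowDialC

/-! # ShadowDialD — part 4/4 of the landing twins of NODE «ShadowDial» (decomp-qadv lens-2 g24; node file
`g24/ShadowDial.lean`, sha256 c1ef15d9c22c1bbf…; generator `g24/tree/gen_twins.py`: namespace `Theses.ShadowDial` →
`Theorems.ShadowDial`, cut at section boundaries, docstrings added where missing, docstring-only import `AffBells22FrameJunta` dropped,
nothing else).
Content: §5 (part 2) the zero-gauge certificates of the multiplexer: test inputs `tIn`, NOT `(m,r)`-table-form once `(m+1)^r < 2^(log₂ N−3)`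
(`mux_not_tableForm`, pigeonhole), every data cell PIVOTAL (`mux_pivotal`), `mux_not_tableForm_zero`, `mux_not_counterForm_zero`. -/

set_option linter.dupNamespace false
noncomputable section
open scoped Classical

namespace Summit.QuantumAdvantage.QuantumAdvantage.Theorems.ShadowDial
open Finset
open Literature.Computability.QuantumComplexity Literature.Computability.QuantumComplexity.RingHLF
open Literature.Computability.MetaComplexity Literature.Computability.MetaComplexity.Smolensky
open Summit.QuantumAdvantage.AdviceFreeQNC0
open Summit.QuantumAdvantage.QuantumAdvantage.Theorems.AnchorDial (outB dev loss_shape_mono)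
open Summit.QuantumAdvantage.QuantumAdvantage.Theorems.HolonomyDial (tPoly tPoly_apply tPoly_mem xorP xorP_mem
  xorP_apply_bool mono_singleton_apply indP indP_apply indP_mem)
open Summit.QuantumAdvantage.QuantumAdvantage.Theorems.StabilizerDial (apIdx apStrat apStrat_mem apStrat_apply pad
  pad_mem rel_pad_iff winset_pad StabFew outB_pad_zero)
open Summit.QuantumAdvantage.QuantumAdvantage.Theorems.SparsityDial (real_loss_of_frac stabFew_mono_mr one_le_logpow)
open Summit.QuantumAdvantage.QuantumAdvantage.Theorems.ResponseDial (mem_dev_apStrat dev_pad_zero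
  not_polylogSparse_of_agree)
open Summit.QuantumAdvantage.QuantumAdvantage.Theorems.CounterDial (CounterForm StabCounter)
open Summit.QuantumAdvantage.QuantumAdvantage.Theorems.AbelianDial (alin TableForm StabTable AbelianLoss3
  NonAbelianLoss3 tableForm_of_counterForm nT pcell qcell pcell_val qcell_val pcell_injective qcell_injective
  pcell_ne_qcell qG qG_apply qG_indB qStrat qStrat_agree qStrat_mem6 q_in_dense_class mem_dev_q_second indB
  oddZeros_indB alin_indB q_not_tableForm_zero q_not_counterForm_zero)
open Summit.QuantumAdvantage.QuantumAdvantage.Theorems.ScaleDial (logpow_add_logpow_le)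

variable {N : ℕ}

section Mux

section TableCert

/-- the address cells switched on by pattern `τ`. -/
def aSet (τ : Fin (aL N) → Bool) : Finset (Fin N) := (univ.filter fun j => τ j = true).image acell

/-- the address cell `acell j` lies in the address pattern set `aSet τ` iff `τ j` is set. -/
theorem mem_aSet_acell (τ : Fin (aL N) → Bool) (j : Fin (aL N)) : acell j ∈ aSet τ ↔ τ j = true := by
  unfold aSet; rw [mem_image]
  constructor
  · rintro ⟨j', hj', h⟩
    rw [← acell_injective h]; exact (mem_filter.1 hj').2
  · intro h; exact ⟨j, mem_filter.2 ⟨mem_univ _, h⟩, rfl⟩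

/-- an address pattern set has at most `aL N` cells. -/
theorem card_aSet_le (τ : Fin (aL N) → Bool) : (aSet τ).card ≤ aL N := by
  unfold aSet
  exact card_image_le.trans ((card_filter_le _ _).trans (by rw [card_univ, Fintype.card_fin]))

/-- no data cell lies in an address pattern set. -/
theorem dcell_not_mem_aSet (hN : 16 ≤ N) (k : Fin N) (τ σ : Fin (aL N) → Bool) : dcell k σ ∉ aSet τ := by
  unfold aSet; rw [mem_image]
  rintro ⟨j, -, h⟩; exact acell_ne_dcell hN j k σ h

/-- cell `0` lies in no address pattern set. -/
theorem zero_not_mem_aSet (hN : 16 ≤ N) (τ : Fin (aL N) → Bool) : (⟨0, by omega⟩ : Fin N) ∉ aSet τ := by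
  unfold aSet; rw [mem_image]
  rintro ⟨j, -, h⟩
  have := congrArg Fin.val h
  rw [acell_val] at this
  simp at this

/-- base set: the address cells of `τ`, plus the parity-padding cell `0` when needed (to land in the odd class). -/
def bSet (hN : 16 ≤ N) (τ : Fin (aL N) → Bool) : Finset (Fin N) :=
  if (N - ((aSet τ).card + 1)) % 2 = 1 then aSet τ else insert ⟨0, by omega⟩ (aSet τ)

/-- the TEST INPUT: base set of `τ` plus the data cell of `σ` at the last position `N − 1`. -/
def tIn (hN : 16 ≤ N) (τ σ : Fin (aL N) → Bool) : Fin N → Bool :=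
  indB (insert (dcell ⟨N - 1, by omega⟩ σ) (bSet hN τ))

/-- the address cell `acell j` lies in the parity-padded pattern set `bSet hN τ` iff `τ j` is set. -/
theorem acell_mem_bSet (hN : 16 ≤ N) (τ : Fin (aL N) → Bool) (j : Fin (aL N)) :
    acell j ∈ bSet hN τ ↔ τ j = true := by
  unfold bSet
  split
  · exact mem_aSet_acell τ j
  · rw [mem_insert, mem_aSet_acell]
    constructor
    · rintro (h | h)
      · have := congrArg Fin.val h
        rw [acell_val] at this
        simp at this
      · exact h
    · exact fun h => Or.inr h

/-- no data cell lies in a parity-padded pattern set. -/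
theorem dcell_not_mem_bSet (hN : 16 ≤ N) (τ σ : Fin (aL N) → Bool) (k : Fin N) : dcell k σ ∉ bSet hN τ := by
  unfold bSet
  split
  · exact dcell_not_mem_aSet hN k τ σ
  · rw [mem_insert, not_or]
    exact ⟨fun h => dcell_ne_zero hN k σ (congrArg Fin.val h), dcell_not_mem_aSet hN k τ σ⟩

/-- the parity pad makes `N − (#bSet + 1)` odd (so the test inputs lie in the ODD class). -/
theorem card_bSet_odd (hN : 16 ≤ N) (τ : Fin (aL N) → Bool) : (N - ((bSet hN τ).card + 1)) % 2 = 1 := by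
  unfold bSet
  split
  · assumption
  · rw [card_insert_of_notMem (zero_not_mem_aSet hN τ)]
    have hA := card_aSet_le τ
    have := aL_add_three_le hN
    omega

/-- the test input `tIn hN τ σ` carries the address `τ` on the address cells. -/
theorem tIn_acell (hN : 16 ≤ N) (τ σ : Fin (aL N) → Bool) (j : Fin (aL N)) : tIn hN τ σ (acell j) = τ j := by
  unfold tIn indB
  have e : acell j ∈ insert (dcell ⟨N - 1, by omega⟩ σ) (bSet hN τ) ↔ τ j = true := by
    rw [mem_insert, acell_mem_bSet]
    exact ⟨fun h => h.elim (fun h' => absurd h' (acell_ne_dcell hN j _ σ)) id, Or.inr⟩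
  rw [Bool.decide_congr e, Bool.decide_eq_true]

/-- the test input `tIn hN τ σ` has the data cell addressed by `τ` (at the last output position) set iff `τ = σ`. -/
theorem tIn_dcell (hN : 16 ≤ N) (τ σ : Fin (aL N) → Bool) :
    tIn hN τ σ (dcell ⟨N - 1, by omega⟩ τ) = decide (τ = σ) := by
  unfold tIn indB
  apply Bool.decide_congr
  rw [mem_insert]
  constructor
  · rintro (h | h)
    · exact dcell_injective _ h
    · exact absurd h (dcell_not_mem_bSet hN τ τ _)
  · rintro rfl; exact Or.inl rfl

/-- every test input `tIn hN τ σ` has an odd number of zeros. -/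
theorem tIn_odd (hN : 16 ≤ N) (τ σ : Fin (aL N) → Bool) : OddZeros (tIn hN τ σ) := by
  unfold tIn
  rw [oddZeros_indB, card_insert_of_notMem (dcell_not_mem_bSet hN τ σ _)]
  exact card_bSet_odd hN τ

/-- the abelian readout of the test input `tIn hN τ σ`: the row of the one set data cell plus the rows of the pattern set. -/
theorem alin_tIn (hN : 16 ≤ N) (m r : ℕ) (V : Fin N → Fin r → ZMod (m + 1)) (τ σ : Fin (aL N) → Bool) :
    alin m r V (tIn hN τ σ) = fun j => V (dcell ⟨N - 1, by omega⟩ σ) j + ∑ i ∈ bSet hN τ, V i j := by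
  unfold tIn
  rw [alin_indB]
  funext j
  rw [sum_insert (dcell_not_mem_bSet hN τ σ _)]

/-- **★ NOT `(m,r)`-TABLE-FORM** once `2^L > (m+1)^r`: two address patterns with the same table row, different outputs. -/
theorem mux_not_tableForm (hN : 16 ≤ N) {m r : ℕ} (hW : (m + 1) ^ r < aW N)
    (v : Fin N → Fin N → Fin r → ZMod (m + 1)) (G : Fin N → (Fin r → ZMod (m + 1)) → Bool) :
    ¬ TableForm m r v G (pad (fun k : Fin N => muxStrat k) (fun _ => 0)) := by
  intro hT
  set k₀ : Fin N := ⟨N - 1, by omega⟩ with hk₀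
  have hk : ¬ (1 ≤ k₀.val ∧ k₀.val < N / 2) := by simp only [hk₀]; omega
  have hcard : Fintype.card (Fin r → ZMod (m + 1)) < Fintype.card (Fin (aL N) → Bool) := by
    rw [Fintype.card_fun, Fintype.card_fun, ZMod.card, Fintype.card_fin, Fintype.card_bool, Fintype.card_fin]
    unfold aW at hW; exact hW
  obtain ⟨τ, τ', hne, hv⟩ := Fintype.exists_ne_map_eq_of_card_lt (fun σ => v k₀ (dcell k₀ σ)) hcard
  have key : ∀ σ, (τ = σ ↔ G k₀ (fun j => v k₀ (dcell k₀ σ) j + ∑ i ∈ bSet hN τ, v k₀ i j) = true) := by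
    intro σ
    have h := hT (tIn hN τ σ) (tIn_odd hN τ σ) k₀
    rw [dev_pad_zero, alin_tIn, mem_dev_mux_second _ _ hk,
      show (fun j => tIn hN τ σ (acell j)) = τ from funext (tIn_acell hN τ σ), hk₀, tIn_dcell,
      decide_eq_true_iff] at h
    rw [hk₀]; exact h
  have h1 := (key τ).1 rfl
  have h2 : G k₀ (fun j => v k₀ (dcell k₀ τ') j + ∑ i ∈ bSet hN τ, v k₀ i j) = true := by
    have e : (fun j => v k₀ (dcell k₀ τ') j + ∑ i ∈ bSet hN τ, v k₀ i j) =
        fun j => v k₀ (dcell k₀ τ) j + ∑ i ∈ bSet hN τ, v k₀ i j := by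
      funext j; rw [show v k₀ (dcell k₀ τ') = v k₀ (dcell k₀ τ) from hv.symm]
    rw [e]; exact h1
  exact hne ((key τ').2 h2)

/-- **★ every data cell is PIVOTAL** for the last output bit: the gate reads all `2^L > N/16` data cells (no polylog-junta). -/
theorem mux_pivotal (hN : 16 ≤ N) (τ : Fin (aL N) → Bool) :
    shadow (fun i : Fin N => muxStrat i) ⟨N - 1, by omega⟩ (tIn hN τ τ) ≠
      shadow (fun i : Fin N => muxStrat i) ⟨N - 1, by omega⟩
        (Function.update (tIn hN τ τ) (dcell ⟨N - 1, by omega⟩ τ) false) := by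
  set k₀ : Fin N := ⟨N - 1, by omega⟩ with hk₀
  have hk : ¬ (1 ≤ k₀.val ∧ k₀.val < N / 2) := by simp only [hk₀]; omega
  set x := tIn hN τ τ with hx
  set x' := Function.update x (dcell k₀ τ) false with hx'
  have ha : ∀ j, x' (acell j) = x (acell j) := fun j =>
    Function.update_of_ne (acell_ne_dcell hN j k₀ τ) _ _
  have haddr : (fun j => x (acell j)) = τ := funext (tIn_acell hN τ τ)
  have haddr' : (fun j => x' (acell j)) = τ := by rw [← haddr]; exact funext ha
  have hk₀ne : k₀ ≠ dcell k₀ τ := fun h => by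
    have h1 := congrArg Fin.val h; have := dcell_lt_last hN k₀ τ; rw [← h1, hk₀] at this; simp at this
  have hnx : nxt k₀ ≠ dcell k₀ τ := fun h => by
    have h1 := congrArg Fin.val h
    have h0 : (nxt k₀).val = 0 := by
      show (N - 1 + 1) % N = 0; rw [Nat.sub_add_cancel (by omega), Nat.mod_self]
    exact dcell_ne_zero hN k₀ τ (by rw [← h1]; exact h0)
  have ht : tGuess x' k₀ = tGuess x k₀ := by
    simp only [hx', tGuess, Function.update_of_ne hk₀ne, Function.update_of_ne hnx]
  have hd : x (dcell k₀ τ) = true := by rw [hx, hk₀, tIn_dcell]; simp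
  have hd' : x' (dcell k₀ τ) = false := Function.update_self _ _ _
  rw [shadow_of_bool _ k₀ x _ (muxStrat_apply_second x k₀ hk), shadow_of_bool _ k₀ x' _ (muxStrat_apply_second x' k₀ hk),
    haddr, haddr', ht, hd, hd']
  cases tGuess x k₀ <;> decide

end TableCert

/-- **★ NOT CHEAPLY TABLE-FORM at the zero gauge**, for every abelian type `(m, r)`, once `n ≥ 16 (m+1)^r + 16`. -/
theorem mux_not_tableForm_zero (m r : ℕ) : ∀ n ≥ 16 * (m + 1) ^ r + 16,
    ¬ ∃ (v : Fin n → Fin n → Fin r → ZMod (m + 1)) (G : Fin n → (Fin r → ZMod (m + 1)) → Bool),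
      TableForm m r v G (pad (fun i : Fin n => muxStrat i) (fun _ => 0)) := by
  rintro n hn ⟨v, G, h⟩
  have hN : 16 ≤ n := by omega
  refine mux_not_tableForm hN ?_ v G h
  have hL : 3 ≤ Nat.log 2 n := Nat.le_log_of_pow_le (by norm_num) (by omega)
  have hlt := Nat.lt_pow_succ_log_self (show 1 < 2 by norm_num) n
  have e := aW_mul_eight (N := n) hL
  rw [pow_succ] at hlt
  omega

/-- **★ NOT CHEAPLY COUNTER-FORM at the zero gauge** (`n ≥ 64`): a counter is a `(2,1)`-table. -/
theorem mux_not_counterForm_zero : ∀ n ≥ 64,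
    ¬ ∃ (a : Fin n → Fin n → ZMod 3) (A : Fin n → Finset (ZMod 3)),
      CounterForm a A (pad (fun i : Fin n => muxStrat i) (fun _ => 0)) := by
  rintro n hn ⟨a, A, h⟩
  exact mux_not_tableForm_zero 2 1 n (by norm_num; omega) ⟨_, _, tableForm_of_counterForm h⟩

end Mux

end Summit.QuantumAdvantage.QuantumAdvantage.Theorems.ShadowDial
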